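import Mathlib.Tactic.NormNum.Prime
import Literature.AlgebraicGeometry.Hyperkaehler.GeneralizedKummerTypeLefschetzStandard
import Literature.AlgebraicGeometry.HodgeTheory.LefschetzStandardInDegree
import HarnessLib

/-!
# Foster 2024, Theorem 1: `B(Y)` for projective varieties of `Kumⁿ`-type IN DEGREES `< 2(n+1)(j-1)/j`, every `n ≥ 2` — NAMED FACT + proved corollaries (Cor. 3, Cor. 71)

Layer `Literature/AlgebraicGeometry/Hyperkaehler`; companion of `GeneralizedKummerTypeLefschetzStandard`
(`Foster2024_lefschetzStandard_kummerType_prime`: Foster's Corollary 2, the case `n + 1` PRIME, where `B(Y)`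
holds in ALL degrees and the tree's all-degrees predicate `HodgeTheory.StandardConjectureBStar` could carry
it).  That file's "What is NOT here" names the present content: "Theorem 1 in composite `n + 1`
(degree-restricted `B`; it would need a degree-wise `*_L` predicate) and Corollary 3 (`n + 1 ≥ 4` even:
degrees `< n + 1`)".  The degree-wise predicate now exists (`HodgeTheory.LefschetzStandardInDegree`, file
`HodgeTheory/LefschetzStandardInDegree`), so Theorem 1 is recorded here for EVERY `n ≥ 2`, with its printed
corollaries PROVED from it: Cor. 3 (`n + 1` even ⇒ degrees `< n + 1`), Cor. 71 (degrees `2` and `3` for every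
`n`), the prime case (degrees `< 2n`), and consistency with the Corollary-2 record.  Written by the
literature seat `hodge-lit-oqh-2` (LT-H4 open-question harvest; Floccari–Varesco 2024 §3 "Some recent
results", Thm. 3.1 = "[foster]") for the ladder HodgeAV rung H3 (the Hodge statement for `Kumⁿ`-type,
`n ≥ 4`: for `n + 1` composite — `n = 5, 7, 8, 9, 11, …` — this is the part of `B` that is in print) and
for the print-strength hypothesis "`B` in degree two" of Varesco 2023 Cor. 4.6 / the all-`n` proof of her
Thm. 5.1 (`Hyperkaehler/TranscendentalHodgeSimilitudesKugaSatake`, whose kernel `….of_kummerType_target` had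
to assume `n + 1` prime).  HONEST FRAMING: a theorem in print, unproved in the tree; nothing here asserts the
Hodge statement for any `Kumⁿ`.

## Source (read at source: held arXiv text `paper:arxiv-2303.14327`, pages p0002, p0021, p0025)

J. Foster, *The Lefschetz standard conjectures for IHSMs of generalized Kummer deformation type in certain
degrees*, Eur. J. Math. 10 (2024), no. 2, Art. 34, doi:10.1007/s40879-024-00744-2 (arXiv:2303.14327)
[`Foster2024`; REFEREED].  One counter numbers all statements of the arXiv text; we cite by it.
* §1.1 (p0002 L14–L22), Foster's `B(X)` and "in degree `k`", verbatim: "For each `k ≤ n`, there exists an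
  algebraic self-correspondence `[𝒵] ∈ H^{2k}(X × X, ℚ)`, arising from a codimension-`k` cycle
  `𝒵 ∈ CH^k(X × X)`, such that the isomorphism `[𝒵]^* : H^{2n-k}(X, ℚ) → H^k(X, ℚ)` is the inverse of the
  isomorphism `L^{n-k}`. If the correspondence `[𝒵]` exists for a particular `k ≤ n`, the Lefschetz standard
  conjecture `B(X)` is said to hold for `X` in degree `k` […]. We note also that the statement of the LSC is
  independent of the choice of polarization on `X` ([K1])."  (Here `n = dim X`; below `dim Y = 2n`.)
* **Theorem 1** (p0002 L26–L27) = **Theorem 86** (p0025 L33–L34), verbatim (Thm. 86): "Let `Y` be a variety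
  of generalized Kummer deformation type of dimension `2n` and let `j > 1` be the smallest prime divisor of
  `n+1`. The Lefschetz standard conjecture holds for `Y` in degrees `< 2(n+1)(j-1)/j`."  (Thm. 1 spells the
  standing hypothesis: "Let `Y` be a projective irreducible holomorphic symplectic manifold (IHSM) of
  generalized Kummer deformation type of dimension `2n`.")
* **Corollary 2** (p0002 L29–L32): `n + 1` prime ⇒ `j = n + 1`, degrees `< 2n`, and with the diagonal in
  the middle degree (Remark 88, p0025) `B(Y)` in all degrees — the record
  `Foster2024_lefschetzStandard_kummerType_prime` (NOT restated here; `of_prime` below is the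
  degrees-`< 2n` sentence, `of_primeRecord` the consistency).
* **Corollary 3** (p0002 L36–L37), verbatim: "For `Y` a projective IHSM of generalized Kummer deformation
  type of dimension `2n` for which `n+1 ≥ 4` is even, then the Lefschetz standard conjectures hold for `Y` in
  degrees `< n+1`."
* **Corollary 71** (p0021 L25–L26), verbatim: "For `Y` a variety of generalized Kummer deformation type, the
  Lefschetz standard conjecture holds in degrees `2` and `3`."
* §1.1 (p0002 L41): "recent work of de Jong and Perry shows that the LSC in degree `2` implies a weakened
  version of the period-index conjecture ([dJP] Theorem 1.6)" — a consumer of `degreeTwo` not in the tree.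
* Floccari–Varesco, Math. Ann. (2024) §3 Thm. 3.1 (held text `paper:arxiv-2308.04865` p0006:L6–L8) cite the
  same theorem as "([foster]) Let `X` be a variety of `Kumⁿ`-type. Then the standard conjectures hold for
  `M_X`. The Künneth projector `H•(X, ℚ) → H²(X, ℚ)` is algebraic." — see "Not here".

## Rendering (tree carriers) and faithfulness

* "projective IHSM of generalized Kummer deformation type of dimension `2n`":
  `Motives.IsSmoothProjective (2 * n) X ∧ IsOfGeneralizedKummerType n X`, `2 ≤ n` — the IDENTICAL convention of
  the Corollary-2 record and of every `Kumⁿ` record of this directory ("IHSM" is a consequence in print: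
  Beauville 1983 Thm. 4 with Prop. 9, the tree's `Beauville1983_irreducibleSymplectic_of_kummerType`; the
  reading of the tree's `AreDeformationEquivalent` is that record's module docstring).  `n ≥ 2`: Foster's
  `Kum_n(A) ⊂ A^{[n+1]}` with "Let `n > 1`" (§2, p0008 L55); generalized Kummer type is an `n ≥ 2` notion in
  Floccari–Varesco §3 ("`n ≥ 2`"); nothing is claimed for `n = 1`.
* "`j > 1` the smallest prime divisor of `n+1`": Mathlib's `(n + 1).minFac` (for `n + 1 ≥ 2` the least prime
  factor, `Nat.minFac_prime`).
* "in degrees `< 2(n+1)(j-1)/j`": for a degree `k : ℕ`, the subtraction- and division-free integer form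
  `j * k + 2 * (n + 1) < 2 * (n + 1) * j`, EQUIVALENT to `k < 2(n+1)(j-1)/j` over `ℚ` for `j > 0`
  (`degreeBound_iff`, proved below).  Every such `k` is `≤ 2n - 1 < dim Y` (`lt_two_mul_of_degreeBound`), so
  all instances are in Foster's range `k ≤ dim` where "degree `k`" means the INVERSE Lefschetz isomorphism
  `H^{4n-k} → Hᵏ` — exactly `HodgeTheory.LefschetzStandardInDegree (2 * n) X η k` (André's `*_L : H^{4n-k} → Hᵏ`
  is that inverse above the middle degree, `lefschetzInvolution_lefschetzPow`).
* POLARISATIONS / COEFFICIENTS: as in the Corollary-2 record — every `η` (the predicate is vacuous unless `η`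
  is a polarisation class; independence of the polarisation is Foster's own remark "[K1]" = Kleiman 1968),
  `ℂ`-coefficients with algebraic = `ℂ`-span of cycle classes (a rational correspondence is a complex one;
  nothing stronger than print).
* Grades: Thm. 1/86, Cor. 3, Cor. 71 REFEREED (Eur. J. Math. 2024).  The fact below is Thm. 86 verbatim in
  this rendering; Cor. 3, Cor. 71 and the prime case are THEOREMS here (arithmetic of the bound:
  `j = 2`, resp. `2j < 2(n+1)(j-1)` and `3j < 2(n+1)(j-1)` for `n ≥ 2`, resp. `j = n + 1`).

## What is NOT here

Floccari–Varesco's two sentences "the standard conjectures hold for `M_X = (X × T_X)/Γₙ`" (Foster Thm. 48: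
`B` for every projective fibre of the universal family `Π : 𝓜̃ → 𝔐⁰_{w⊥}`, with Markman's theorem that `M_X`
is such a fibre) and "the Künneth projector `H•(X, ℚ) → H²(X, ℚ)` is algebraic" / Rem. 3.2 "the standard
conjectures hold for the motive `h(X)^{Γₙ}`": the first needs Markman's fourfold `T_X` and `M_X` as carriers,
the second and third are statements about homological MOTIVES (direct summands of `h(X)`), which the
real-carrier layer does not model — on the real carriers a correspondence is already read degree by degree
(`IsAlgebraicCorrespondence` on `Hᵃ → Hᵇ`), so no seat there needs the projector; Theorem 48 itself (moduli
spaces of sheaves on abelian surfaces and their projective deformations); Theorem 70 (the surjectivity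
criterion); the conditional extension to all even `n + 1` (arXiv:2512.04114); any proof (Markman's universal
family, Verbitsky's hyperholomorphic sheaves, the decomposition theorem / Göttsche–Soergel — XL in the tree).
-/

noncomputable section

namespace Literature.AlgebraicGeometry.Hyperkaehler

/-- **Foster 2024, Theorem 1 (= Theorem 86): for every smooth projective complex variety `Y` of `Kumⁿ`-type,
`n ≥ 2`, Grothendieck's `B(Y)` — André's `*_L : H^{4n-k}(Y(ℂ); ℂ) → Hᵏ(Y(ℂ); ℂ)` is induced by an algebraic
class on `Y × Y` — holds in every degree `k < 2(n+1)(j-1)/j`, where `j` is the smallest prime divisor of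
`n + 1`** (printed sentences quoted verbatim in the module docstring: "The Lefschetz standard […] holds for
`Y` in degrees `< 2(n+1)(j-1)/j`").  Rendering: for all `n ≥ 2`, all `X` with
`Motives.IsSmoothProjective (2 * n) X` and `IsOfGeneralizedKummerType n X` (the convention of the Corollary-2
record `Foster2024_lefschetzStandard_kummerType_prime`; "IHSM" is a consequence in print), every
`η ∈ H²(X(ℂ); ℂ)` (vacuous unless a polarisation class; independence of the polarisation: Kleiman, Foster's
"[K1]") and every degree `k` with `j·k + 2(n+1) < 2(n+1)·j`, `j = (n + 1).minFac` — the integer form of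
`k < 2(n+1)(j-1)/j` (`degreeBound_iff`) — the tree's degree-`k` predicate
`HodgeTheory.LefschetzStandardInDegree (2 * n) X η k` holds.  A THEOREM in print (REFEREED: Eur. J. Math. 10
(2024); unproved in the tree — Markman's universal family of moduli spaces of sheaves on abelian surfaces,
hyperholomorphic sheaves, the decomposition theorem).  Consequences proved below: Cor. 71 (degrees 2 and 3,
all `n ≥ 2`), Cor. 3 (`n + 1` even: degrees `< n + 1`), the prime case (degrees `< 2n`).
[cite: Foster2024, Thm. 1 (§1.1, arXiv:2303.14327 p. 2) = Thm. 86 (§5.2, p. 25)]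
[cite: Kleiman1968AlgebraicCycles, §2 (independence of the polarisation)] -/
def Foster2024_lefschetzStandard_kummerType_degrees : Prop :=
  ∀ (n : ℕ), 2 ≤ n → ∀ ⦃X : Motives.SchemeOver ℂ⦄, Motives.IsSmoothProjective (2 * n) X →
    IsOfGeneralizedKummerType n X → ∀ (η : HodgeTheory.complexBetti X 2) (k : ℕ),
      (n + 1).minFac * k + 2 * (n + 1) < 2 * (n + 1) * (n + 1).minFac →
        HodgeTheory.LefschetzStandardInDegree (2 * n) X η k

namespace Foster2024_lefschetzStandard_kummerType_degrees

/-! ### Arithmetic of the degree bound `k < 2(n+1)(j-1)/j` -/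

/-- The integer rendering of Foster's bound is the printed one: for `j > 0`,
`j·k + 2(n+1) < 2(n+1)·j ⟺ k < 2(n+1)(j-1)/j` (over `ℚ`). [cite: Foster2024, Thm. 1 (§1.1)] -/
theorem degreeBound_iff (n k : ℕ) {j : ℕ} (hj : 0 < j) :
    j * k + 2 * (n + 1) < 2 * (n + 1) * j ↔ (k : ℚ) < 2 * (n + 1) * (j - 1) / j := by
  have hjq : (0 : ℚ) < j := by exact_mod_cast hj
  rw [lt_div_iff₀ hjq]
  constructor
  · intro h
    have h' : ((j * k + 2 * (n + 1) : ℕ) : ℚ) < ((2 * (n + 1) * j : ℕ) : ℚ) := by exact_mod_cast h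
    push_cast at h'
    nlinarith
  · intro h
    have h' : ((j * k + 2 * (n + 1) : ℕ) : ℚ) < ((2 * (n + 1) * j : ℕ) : ℚ) := by
      push_cast
      nlinarith
    exact_mod_cast h'

/-- Every degree in Foster's range is below the middle: `j·k + 2(n+1) < 2(n+1)·j` with `j = (n+1).minFac`
forces `k < 2n` (since `j ≤ n + 1`), in particular `k ≤ dim Y = 2n`, the range in which "degree `k`" is
defined in print. [cite: Foster2024, §1.1 and Thm. 1] -/
theorem lt_two_mul_of_degreeBound {n k : ℕ} (hn : 2 ≤ n)
    (hk : (n + 1).minFac * k + 2 * (n + 1) < 2 * (n + 1) * (n + 1).minFac) : k < 2 * n := by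
  have hle : (n + 1).minFac ≤ n + 1 := Nat.minFac_le (by omega)
  have hj1 : 1 ≤ (n + 1).minFac := Nat.minFac_pos (n + 1)
  rcases Nat.lt_or_ge k (2 * n) with hlt | hcon
  · exact hlt
  · exfalso
    have h1 : (n + 1).minFac * (2 * n) ≤ (n + 1).minFac * k := Nat.mul_le_mul_left _ hcon
    nlinarith

/-- Degree `2` is in Foster's range for every `n ≥ 2`: `2j < 2(n+1)(j-1)`, `j = (n+1).minFac`
(the arithmetic behind Cor. 71, degree 2). [cite: Foster2024, Cor. 71 (§5.1, arXiv:2303.14327 p. 21)] -/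
theorem degreeBound_two {n : ℕ} (hn : 2 ≤ n) :
    (n + 1).minFac * 2 + 2 * (n + 1) < 2 * (n + 1) * (n + 1).minFac := by
  have hp : ((n + 1).minFac).Prime := Nat.minFac_prime (by omega)
  have h2 : 2 ≤ (n + 1).minFac := hp.two_le
  nlinarith

/-- Degree `3` is in Foster's range for every `n ≥ 2`: `3j < 2(n+1)(j-1)`, `j = (n+1).minFac` (if `j = 2`
then `n + 1` is even, hence `≥ 4`; if `j ≥ 3` directly) — the arithmetic behind Cor. 71, degree 3.
[cite: Foster2024, Cor. 71 (§5.1, arXiv:2303.14327 p. 21)] -/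
theorem degreeBound_three {n : ℕ} (hn : 2 ≤ n) :
    (n + 1).minFac * 3 + 2 * (n + 1) < 2 * (n + 1) * (n + 1).minFac := by
  have hp : ((n + 1).minFac).Prime := Nat.minFac_prime (by omega)
  have h2 : 2 ≤ (n + 1).minFac := hp.two_le
  rcases Nat.lt_or_ge 2 ((n + 1).minFac) with h3 | h3
  · -- `j ≥ 3`
    nlinarith
  · -- `j = 2`: then `2 ∣ n + 1`, so `n + 1 ≠ 3`, hence `n + 1 ≥ 4`
    have hj : (n + 1).minFac = 2 := le_antisymm h3 h2
    have hdvd : 2 ∣ n + 1 := by rw [← hj]; exact Nat.minFac_dvd (n + 1)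
    rw [hj]
    omega

/-- For `n + 1` prime the bound is `2n`: `j = n + 1` and `(n+1)k + 2(n+1) < 2(n+1)² ⟺ k < 2n`
(Cor. 2: "When `n+1` is prime, `j = n+1`"). [cite: Foster2024, Cor. 2 (§1.1)] -/
theorem degreeBound_of_prime {n k : ℕ} (hp : (n + 1).Prime) (hk : k < 2 * n) :
    (n + 1).minFac * k + 2 * (n + 1) < 2 * (n + 1) * (n + 1).minFac := by
  rw [hp.minFac_eq]
  nlinarith

/-- For `n + 1` even the bound is `n + 1`: `j = 2` and `2k + 2(n+1) < 4(n+1) ⟺ k < n + 1`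
(Cor. 3: "when `n+1` is even, `j=2`"). [cite: Foster2024, Cor. 3 (§1.1)] -/
theorem degreeBound_of_even {n k : ℕ} (he : 2 ∣ n + 1) (hk : k < n + 1) :
    (n + 1).minFac * k + 2 * (n + 1) < 2 * (n + 1) * (n + 1).minFac := by
  have hj : (n + 1).minFac = 2 := (Nat.minFac_eq_two_iff (n + 1)).2 he
  rw [hj]
  omega

/-! ### The printed corollaries, proved from Theorem 1 -/

/-- **Foster 2024, Corollary 71 (degree 2): for every smooth projective `Y` of `Kumⁿ`-type, `n ≥ 2`, and
every `η`, `B(Y)` holds in degree `2`** — the Lefschetz inverse `H^{4n-2}(Y(ℂ); ℂ) → H²(Y(ℂ); ℂ)` is induced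
by an algebraic class on `Y × Y` ("the Lefschetz standard […] holds in degrees `2` and `3`").  This is the
print-strength hypothesis "`X` satisfies the Lefschetz standard [statement] in degree two" of Varesco 2023
Cor. 4.6 for `Kumⁿ` targets, for ALL `n ≥ 2` (the tree's record of Cor. 4.6 takes the all-degrees `B`).
[cite: Foster2024, Cor. 71 (§5.1, arXiv:2303.14327 p. 21)] -/
theorem degreeTwo (h : Foster2024_lefschetzStandard_kummerType_degrees)
    {n : ℕ} (hn : 2 ≤ n) {X : Motives.SchemeOver ℂ}
    (hX : Motives.IsSmoothProjective (2 * n) X) (hK : IsOfGeneralizedKummerType n X)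
    (η : HodgeTheory.complexBetti X 2) : HodgeTheory.LefschetzStandardInDegree (2 * n) X η 2 :=
  h n hn hX hK η 2 (degreeBound_two hn)

/-- **Foster 2024, Corollary 71 (degree 3): for every smooth projective `Y` of `Kumⁿ`-type, `n ≥ 2`, and
every `η`, `B(Y)` holds in degree `3`** (`H^{4n-3}(Y(ℂ); ℂ) → H³(Y(ℂ); ℂ)`; `b₃(Y) = 8`).
[cite: Foster2024, Cor. 71 (§5.1, arXiv:2303.14327 p. 21)] -/
theorem degreeThree (h : Foster2024_lefschetzStandard_kummerType_degrees)
    {n : ℕ} (hn : 2 ≤ n) {X : Motives.SchemeOver ℂ}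
    (hX : Motives.IsSmoothProjective (2 * n) X) (hK : IsOfGeneralizedKummerType n X)
    (η : HodgeTheory.complexBetti X 2) : HodgeTheory.LefschetzStandardInDegree (2 * n) X η 3 :=
  h n hn hX hK η 3 (degreeBound_three hn)

/-- **Foster 2024, Corollary 3: for `Y` smooth projective of `Kumⁿ`-type with `n + 1` even (`n ≥ 2`, so
`n + 1 ≥ 4`), `B(Y)` holds in every degree `k < n + 1`** ("for which `n+1 ≥ 4` is even, then the Lefschetz
standard conjectures hold for `Y` in degrees `< n+1`"). [cite: Foster2024, Cor. 3 (§1.1, arXiv:2303.14327 p. 2)] -/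
theorem of_even (h : Foster2024_lefschetzStandard_kummerType_degrees)
    {n : ℕ} (hn : 2 ≤ n) (he : 2 ∣ n + 1) {X : Motives.SchemeOver ℂ}
    (hX : Motives.IsSmoothProjective (2 * n) X) (hK : IsOfGeneralizedKummerType n X)
    (η : HodgeTheory.complexBetti X 2) {k : ℕ} (hk : k < n + 1) :
    HodgeTheory.LefschetzStandardInDegree (2 * n) X η k :=
  h n hn hX hK η k (degreeBound_of_even he hk)

/-- **Foster 2024, Theorem 1 in the prime case: for `Y` smooth projective of `Kumⁿ`-type with `n + 1` prime
(`n ≥ 2`), `B(Y)` holds in every degree `k < 2n`** ("When `n+1` is prime, `j = n+1`"; with the diagonal in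
the middle degree this is Corollary 2, the all-degrees record `Foster2024_lefschetzStandard_kummerType_prime`).
[cite: Foster2024, Thm. 1 and Cor. 2 (§1.1); Remark 88 (§5.2, p. 25)] -/
theorem of_prime (h : Foster2024_lefschetzStandard_kummerType_degrees)
    {n : ℕ} (hn : 2 ≤ n) (hp : (n + 1).Prime) {X : Motives.SchemeOver ℂ}
    (hX : Motives.IsSmoothProjective (2 * n) X) (hK : IsOfGeneralizedKummerType n X)
    (η : HodgeTheory.complexBetti X 2) {k : ℕ} (hk : k < 2 * n) :
    HodgeTheory.LefschetzStandardInDegree (2 * n) X η k :=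
  h n hn hX hK η k (degreeBound_of_prime hp hk)

/-- `Kum⁵`-type spelling (`n + 1 = 6`, `j = 2`, the first composite case of the ladder's `n ≥ 4` range): for
every smooth projective tenfold of `Kum⁵`-type, `B` holds in degrees `k ≤ 5` (`< n + 1 = 6`), in particular
in degree `2`. [cite: Foster2024, Cor. 3 (§1.1)] -/
theorem kum5Type (h : Foster2024_lefschetzStandard_kummerType_degrees)
    {X : Motives.SchemeOver ℂ} (hX : Motives.IsSmoothProjective 10 X)
    (hK : IsOfGeneralizedKummerType 5 X) (η : HodgeTheory.complexBetti X 2) {k : ℕ} (hk : k < 6) :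
    HodgeTheory.LefschetzStandardInDegree 10 X η k :=
  h.of_even (n := 5) (by norm_num) (by norm_num) hX hK η hk

/-- `Kum⁷`-type spelling (`n + 1 = 8`, `j = 2`): `B` in degrees `k < 8` for every smooth projective
fourteenfold of `Kum⁷`-type. [cite: Foster2024, Cor. 3 (§1.1)] -/
theorem kum7Type (h : Foster2024_lefschetzStandard_kummerType_degrees)
    {X : Motives.SchemeOver ℂ} (hX : Motives.IsSmoothProjective 14 X)
    (hK : IsOfGeneralizedKummerType 7 X) (η : HodgeTheory.complexBetti X 2) {k : ℕ} (hk : k < 8) :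
    HodgeTheory.LefschetzStandardInDegree 14 X η k :=
  h.of_even (n := 7) (by norm_num) (by norm_num) hX hK η hk

/-- `Kum⁸`-type spelling (`n + 1 = 9`, `j = 3`, bound `2·9·2/3 = 12`): `B` in degrees `k < 12` for every
smooth projective sixteenfold of `Kum⁸`-type. [cite: Foster2024, Thm. 1 (§1.1)] -/
theorem kum8Type (h : Foster2024_lefschetzStandard_kummerType_degrees)
    {X : Motives.SchemeOver ℂ} (hX : Motives.IsSmoothProjective 16 X)
    (hK : IsOfGeneralizedKummerType 8 X) (η : HodgeTheory.complexBetti X 2) {k : ℕ} (hk : k < 12) :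
    HodgeTheory.LefschetzStandardInDegree 16 X η k := by
  refine h 8 (by norm_num) hX hK η k ?_
  have h9 : (8 + 1 : ℕ).minFac = 3 := by norm_num
  rw [h9]
  omega

/-- Consistency with the Corollary-2 record: `Foster2024_lefschetzStandard_kummerType_prime` (all-degrees `B`
for `n + 1` prime) gives `B` in EVERY degree `k` — in particular everything `of_prime` gives, and the middle
degree. [cite: Foster2024, Cor. 2 (§1.1)] -/
theorem of_primeRecord (h' : Foster2024_lefschetzStandard_kummerType_prime) {n : ℕ} (hp : (n + 1).Prime)
    {X : Motives.SchemeOver ℂ} (hX : Motives.IsSmoothProjective (2 * n) X) (hK : IsOfGeneralizedKummerType n X)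
    (η : HodgeTheory.complexBetti X 2) (k : ℕ) : HodgeTheory.LefschetzStandardInDegree (2 * n) X η k :=
  HodgeTheory.lefschetzStandardInDegree_of_bStar (h' n hp hX hK η) k

end Foster2024_lefschetzStandard_kummerType_degrees

end Literature.AlgebraicGeometry.Hyperkaehler

end
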